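import Summits.CriticalPhenomena.PercolationContinuityZ3.Theorems.PercNearOneGluingNoHeavyLowerTailSahiCombMixFourSlot
import Summits.CriticalPhenomena.PercolationContinuityZ3.Theorems.PercNearOneGluingNoHeavyLowerTailSahiCombMixAtoms
import Summits.CriticalPhenomena.PercolationContinuityZ3.Theorems.PercNearOneGluingNoHeavyLowerTailSahiCombMixFour
import Summits.CriticalPhenomena.PercolationContinuityZ3.Theorems.SahiMasterFamily

/-!
# The comb (tensor-Bernstein) hierarchy for Sahi's `E_k`, XXXIX: comb H-MIX(4) — the singleton four-slot cell with ONE mixed event (`|G| = 1`)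

Support file of the one-cut programme (crux `NoHeavyLowerTail`, stmt-CriticalPhenomena-4575; cell `prim-masterthm`, seat P3, gen 8; HIERARCHY.md §15(d),(i)).
The first of the four classes of `SahiCombMix.CombFourSingletonCells`: OR-ing the coordinate `e` into ONE of four events `U_0, …, U_3` (increasing or not, ignoring `e`,
with `CombHereditary U`).  The cell is AFFINE along `p_e`: `E_4(U_0 ∪ [e], U_1, U_2, U_3) = (1 − p_e)E_4(U) + 2p_e E_3(U_1, U_2, U_3)`; in the degree-4 Bernstein form of
`sahiE_four_mixCoord_eq` the coefficients are `E_4(U)`, `3E_4 + 2E_3`, `3E_4 + 6E_3`, `E_4 + 6E_3`, `2E_3` (inhomogeneous LP kit j113449 confirms: two rows, no free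
part) — all comb-positive off `e` from the two hereditary comb rows.
* `orCoord_eq_mixCoord_true/false` — the OR-ed events as `mixCoord` slots; `secAt_univ'` (`ind_univ_eq_one` is reused from `…SahiMasterFamily`).
* **`combPos_fourSlot_G1`** — the cell for `G = (true, false, false, false)`. [this work]
-/

noncomputable section

open scoped Classical

namespace Summit.CriticalPhenomena.PercolationContinuityZ3.Theorems

open Finset Function
open Literature.Combinatorics.Sahi2008
open Literature.Probability.Percolation.DecisionTree (ind ind_of_mem ind_of_not_mem ind_nonneg)
open SahiComb
open SahiCombDisjunct (orCoord)
open SahiCombHereditary (CombHereditary)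

variable {ι : Type} [Fintype ι]

namespace SahiCombMix

omit [Fintype ι] in
/-- A mixed event is the `mixCoord` slot `(U_j, Ω)`. [this work] -/
theorem orCoord_eq_mixCoord_true {n : ℕ} (U : Fin n → Set (Set ι)) (e : ι) (G : Fin n → Bool) (j : Fin n) (hj : G j = true) :
    orCoord U e G j = mixCoord e (U j) Set.univ := by
  unfold SahiCombDisjunct.orCoord
  rw [hj]
  ext ω; simp [mem_mixCoord]

omit [Fintype ι] in
/-- An unmixed event is the `mixCoord` slot `(U_j, U_j)`. [this work] -/
theorem orCoord_eq_mixCoord_false {n : ℕ} (U : Fin n → Set (Set ι)) (e : ι) (G : Fin n → Bool) (j : Fin n) (hj : G j = false) :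
    orCoord U e G j = mixCoord e (U j) (U j) := by
  unfold SahiCombDisjunct.orCoord
  rw [hj]
  ext ω
  simp only [cond_false, mem_mixCoord]
  tauto

omit [Fintype ι] in
/-- `Ω` ignores every coordinate. [folklore] -/
theorem secAt_univ' (e : ι) (b : Bool) : secAt e b (Set.univ : Set (Set ι)) = Set.univ := by
  ext ω; simp [mem_secAt]

/-- **The singleton four-slot cell with one mixed event** (`G = (1,0,0,0)`) is comb-positive at multidegree `4`. [this work] -/
theorem combPos_fourSlot_G1 (U : Fin 4 → Set (Set ι)) (e : ι) (hUe : ∀ (j : Fin 4) (b : Bool), secAt e b (U j) = U j) (hU : CombHereditary U) :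
    CombPos (fun _ : ι => 4) (fun p => sahiE (bernoulliWeight p) 4 (fun j => ind (orCoord U e (![true, false, false, false] : Fin 4 → Bool) j))) := by
  -- the slots as `mixCoord e (U j) (Q j)` with `Q = (Ω, U_1, U_2, U_3)`
  set Q : Fin 4 → Set (Set ι) := ![Set.univ, U 1, U 2, U 3] with hQdef
  have eS : (fun j => ind (orCoord U e (![true, false, false, false] : Fin 4 → Bool) j)) = fun j => ind (mixCoord e (U j) (Q j)) := by
    funext j; fin_cases j
    · exact congrArg ind (orCoord_eq_mixCoord_true U e _ 0 rfl)
    · exact congrArg ind (orCoord_eq_mixCoord_false U e _ 1 rfl)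
    · exact congrArg ind (orCoord_eq_mixCoord_false U e _ 2 rfl)
    · exact congrArg ind (orCoord_eq_mixCoord_false U e _ 3 rfl)
  have hQ : ∀ (j : Fin 4) (b : Bool), secAt e b (Q j) = Q j := by
    intro j b; fin_cases j
    · exact secAt_univ' e b
    · exact hUe 1 b
    · exact hUe 2 b
    · exact hUe 3 b
  have hPQ : ∀ j : Fin 4, U j ⊆ Q j := by
    intro j; fin_cases j
    · exact Set.subset_univ _
    · exact subset_rfl
    · exact subset_rfl
    · exact subset_rfl
  -- the two hereditary comb rows, in moment form
  have eU : (fun j => ind (⋂ i ∈ (![({0} : Finset (Fin 4)), {1}, {2}, {3}] : Fin 4 → Finset (Fin 4)) j, U i))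
      = ![ind (U 0), ind (U 1), ind (U 2), ind (U 3)] := by
    funext j; fin_cases j <;> simp
  have eV : (fun j => ind (⋂ i ∈ (![({1} : Finset (Fin 4)), {2}, {3}] : Fin 3 → Finset (Fin 4)) j, U i)) = ![ind (U 1), ind (U 2), ind (U 3)] := by
    funext j; fin_cases j <;> simp
  have r4 := hU.row_off e hUe 4 ![({0} : Finset (Fin 4)), {1}, {2}, {3}]
  rw [eU] at r4
  have r3 := (hU.row_off e hUe 3 ![({1} : Finset (Fin 4)), {2}, {3}]).mono (deg_off_mono e (show 3 ≤ 4 by norm_num))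
  rw [eV] at r3
  have r4m := r4
  simp only [sahiE_four] at r4m
  simp only [sahiE_three] at r3
  have eP : (fun j => ind (U j)) = ![ind (U 0), ind (U 1), ind (U 2), ind (U 3)] := by funext j; fin_cases j <;> rfl
  have eQ : (fun j => ind (Q j)) = ![1, ind (U 1), ind (U 2), ind (U 3)] := by
    funext j; fin_cases j <;> simp [hQdef, ind_univ_eq_one]
  have q0 : ind (Q 0) = 1 := by simp [hQdef, ind_univ_eq_one]
  have q1 : Q 1 = U 1 := rfl
  have q2 : Q 2 = U 2 := rfl
  have q3 : Q 3 = U 3 := rfl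
  rw [eS]
  refine combPos_four_mixCoord_of_coeffs e U Q hUe hQ hPQ ?_ ?_ ?_ ?_ ?_
  · rw [eP]; exact r4
  · refine ((r4m.smul (by norm_num : (0:ℝ) ≤ 3)).add (r3.smul (by norm_num : (0:ℝ) ≤ 2))).congr fun p => ?_
    simp only [mix4C1, q0, q1, q2, q3, one_mul, mul_one, ex_one (sum_bernoulliWeight p)]
    ring
  · refine ((r4m.smul (by norm_num : (0:ℝ) ≤ 3)).add (r3.smul (by norm_num : (0:ℝ) ≤ 6))).congr fun p => ?_
    simp only [mix4C2, q0, q1, q2, q3, one_mul, mul_one, ex_one (sum_bernoulliWeight p)]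
    ring
  · refine ((r4m.smul (by norm_num : (0:ℝ) ≤ 1)).add (r3.smul (by norm_num : (0:ℝ) ≤ 6))).congr fun p => ?_
    simp only [mix4C3, q0, q1, q2, q3, one_mul, mul_one, ex_one (sum_bernoulliWeight p)]
    ring
  · refine (r3.smul (by norm_num : (0:ℝ) ≤ 2)).congr fun p => ?_
    rw [eQ, sahiE_four]
    simp only [one_mul, ex_one (sum_bernoulliWeight p)]
    ring

end SahiCombMix

end Summit.CriticalPhenomena.PercolationContinuityZ3.Theorems

end
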